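import Summits.CriticalPhenomena.SAWScalingLimit.Theorems.SAWRenewalTightnessTubeLowerBoundOctantReduction
import Summits.CriticalPhenomena.SAWScalingLimit.Theorems.SAWRenewalTightnessTubeLowerBoundDominoFloor
import Summits.CriticalPhenomena.SAWScalingLimit.Theorems.SAWRenewalTightnessTubeLowerBoundQuarterFlux
import Summits.CriticalPhenomena.SAWScalingLimit.Theorems.SAWRenewalTightnessTubeLowerBoundCornerStaircaseHelpers
import Summits.CriticalPhenomena.SAWScalingLimit.Theorems.SAWRenewalTightnessTubeLowerBoundCornerStaircase
import Summits.CriticalPhenomena.SAWScalingLimit.Theorems.SAWRenewalTightnessTubeLowerBoundLassoGluing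
import Summits.CriticalPhenomena.SAWScalingLimit.Theorems.SAWRenewalTightnessTubeLowerBoundCeilingOfExponent
import Summits.CriticalPhenomena.SAWScalingLimit.Theorems.SAWRenewalTightnessTubeLowerBoundDominoStaircase
import Summits.CriticalPhenomena.SAWScalingLimit.Theorems.TubeLowerBound.Negative.TubeLowerBoundFixedWidth
import Literature.Probability.RandomPlanarGeometry.BDGS2012

/-!
# Line `Sketch` = `lasso-repair-poly-hw` — skeleton for the crux `SAWRenewalTightness.TubeLowerBound`
(LEAD c2, prover-line-stmt-CriticalPhenomena-4730-c2-0, 2026-08-16 — STATUS 16:45Z: S2 p103890, S3 p107108+p111288, S4 p110864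
LANDED and wired in by name; conditional closure `Theorems/SAWRenewalTightnessTubeLowerBoundOfCountCeiling.lean` p113604;
ONLY `stub_countCeiling` (S1 = PolyHW, open) carries a `sorry`; reshaped from ideator 2-g2's evidence skeleton
`20260816T031733Z-Sketch.lean` and the idea card `Cruxes/TubeLowerBound/Ideas/lasso-repair-poly-hw.md`;
crux item stmt-CriticalPhenomena-4730, rank 4 of `route-CriticalPhenomena-SAWRenewalTightness`.)

Crux (FIXED, by name): `TubeLowerBound` — there are `C` and `c > 0` such that for all `u v ∈ ℤ²` and `ℓ ≥ 1` with
`|u − v| ≤ ℓ` some partial sum of the `x_c`-mass of self-avoiding walks `u → v` whose vertices stay within `ℓ/10 + 2`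
of the segment `[u, v]` is `≥ c ℓ^{−C}`.  ALL directions `v − u`.

## The line (4 registered stubs; composition `TubeLowerBound_of` kernel-checked, no `sorry` of its own)

The three planned lines reduce the crux to a pointwise polynomial FLOOR for a boundary-started critical family
(corner crossing / wedge bridge / span renewal), open in print.  This line replaces the floor by a CEILING:

* S1 `stub_countCeiling` (OPEN, HARDEST — the lead's): polynomial Hammersley–Welsh in mass form,
  `a_n := c_n x_c^n ≤ (n+1)^C` for all `n` (`c_n = Zd.count 2 n`, `x_c = 1/μ`; `a_0 = 1`, `a_1 = 4x_c ≈ 1.52`, hence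
  the `(n+1)`).  Equivalent to `γ < ∞`; in print: `a_n ≤ e^{κ√n}` (HW 1962, tree `BDGS2012_HammersleyWelsh_holds`),
  `e^{O(n^{1/2-ε})}` subsequentially on `ℤ²` (Duminil-Copin–Ganguly–Hammond–Manolescu, AoP 2020, arXiv:1809.00760);
  implied by the registered conjecture `EnumerationExponentConjecture2D` (S4).  Not finitely refutable (∃C).
* S2 `stub_lassoGluing` (provable now, M–L; finite combinatorics): the TWO-PIECE LASSO INEQUALITY.  For confining
  predicates `P ⊆ R`, `e₁ + Q ⊆ R` (NO separation hypothesis, contrast `CornerStaircase.tubeMass_concat`):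
  `T(P,e₁,M) · T(Q,e₂,N) ≤ (M+1) · A(M) · A(N) · T(R, e₁+e₂, M+N)`, where
  `T(P,e,N) = Σ_{n≤N} Σ_{ω ∈ sawFun 2 n e, ∀ i ≤ n, P (ω i)} x_c^n` and `A(M) = Σ_{k≤M} c_k x_c^k`.
  MAP: for `ω₁ ∈ sawFun m e₁` (`P`-confined), `ω₂ ∈ sawFun n e₂` (`Q`-confined) let `t ≤ m` be the FIRST time with
  `ω₁ t ∈ {e₁ + ω₂ j : j ≤ n}` (it exists: `ω₁ m = e₁ = e₁ + ω₂ 0`) and `s ≤ n` the unique index with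
  `e₁ + ω₂ s = ω₁ t`; output `γ := ω₁[0..t]` followed by `e₁ + ω₂[s..n]`, i.e. `γ i = ω₁ i` (`i ≤ t`),
  `γ (t+k) = e₁ + ω₂ (s+k)` (`k ≤ n−s`); `γ ∈ sawFun 2 (t+n−s) (e₁+e₂)` is self-avoiding BECAUSE `t` is minimal
  (`ω₁[0..t)` misses all of `e₁ + ω₂`), `R`-confined, `t + n − s ≤ M + N`.  FIBRE: `(m,ω₁,n,ω₂) ↦ (γ, t, τ, η)` with
  `τ k := ω₁ (t+k) − ω₁ t` (`k ≤ m−t`, a SAW from `0`, `τ ∈ saws 2 (m−t)`) and `η := ω₂[0..s] ∈ saws 2 s` is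
  INJECTIVE (`ω₁ = γ[0..t] ⋆ τ`, `ω₂ = η ⋆ (γ[t..] − e₁)`, `m = t + |τ|`, `n = |η| + (|γ| − t)`), and
  `x_c^{m+n} = x_c^{|γ|} x_c^{|τ|} x_c^{|η|}`; summing over the image inside
  `(Σ_{L ≤ M+N} F_R(L)) × {t ≤ M} × (Σ_{a ≤ M} saws a) × (Σ_{b ≤ N} saws b)` gives the bound (`Finset.sum_sigma'`,
  `Finset.sum_image` for the injection, `Finset.sum_le_sum_of_subset_of_nonneg`; template:
  `CornerStaircase.sum_mul_sum_le_of_glue`).  Exact-enumeration check: lead's `num/lasso_check.py` (R = 1 dominoes,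
  M,N ≤ 7, and the free case): LHS ≤ RHS with slack ≥ 150×.
* S3 `stub_dominoStaircase` (provable now, L): `S2 → S1 → FirstOctantTubeFloor` (the landed target of both sibling
  lines, `Theorems/SAWRenewalTightnessTubeLowerBoundDefs.lean`).  For naturals `b ≤ a`, `ℓ₀ = max(1,|(a,b)|)`:
  `nR := min 40 a` rounds through the corners `Q_j = (⌊ja/nR⌋, ⌊jb/nR⌋)` (`CornerStaircase.xc/yc/corner_facts` with 20 ↦ 40,
  or reuse `nR = min 20 a` — see TUBE); round `j+1` = a horizontal LEG `Q_j → (x_{j+1}, y_j)` of length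
  `Δx ≥ 1` then a vertical LEG of length `Δy ≥ 0` to `Q_{j+1}`.  A leg of length `L` is: `L = 0` nothing; `L ∈ {1,2}`
  unit steps (`CornerStaircase.criticalFugacity_le_tubeMass_step`, mass `x_c` each); `L ≥ 3` the DOMINO of
  `R = ⌊(L−1)/2⌋ ≥ 1` (landed `stub_dominoFloor stub_quarterFlux : DominoFloor`: walks `0 → (2R+1,0)` in
  `[−R,3R+1]×[−R,R]`, lengths `< 2(2R−1)²+2`, mass `≥ x_c/(16(2R+1))`; vertical dominoes by
  `CornerStaircase.tubeMass_swap_le`) followed by `L − (2R+1) ∈ {0,1}` unit steps.  EVERY gluing (≤ 4·nR + O(1) of them)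
  is an application of S2 with `R :=` the tube predicate of `FirstOctantTubeFloor` (so only `box ⊆ tube` is needed,
  never disjointness): mass multiplies by `piece / ((M+1) A(M) A(N))`, and with S1, `A(M) ≤ (M+1)^{C+1}`; all budgets are
  `≤ N_tot ≤ 200·8ℓ₀²` (domino budget `2(2R−1)²+1 ≤ 2L² ≤ 8ℓ₀²`), every piece has mass `≥ x_c²/(32·2ℓ₀)`, so the total is
  `≥ c' ℓ₀^{−C'}` with `C', c'` depending on `C` only.  TUBE (`infDist_segment_le_coord` with `s = clamp(p₀/a)`): a
  point of the box of a leg of round `j+1` is within `R + 1 ≤ (a/nR+1)/2 + 1` (sup-distance) of the leg, and the leg is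
  within `b/nR + 1` vertically of the segment, so `infDist ≤ 2(a/nR + 2) + b/nR + 1 ≤ 3a/nR + 5 ≤ a/10 + 2` once
  `nR = 40 ≤ a` and `a ≥ 120`; for `a < 120` all legs have length `≤ 3`... (small case: take `nR = a`, legs of length
  `Δx = 1`, `Δy ∈ {0,1}` = unit steps, the digital staircase, deviation `< 2`, mass `x_c^{a+b} ≥ x_c^{240}`, exactly as
  `CornerStaircase.stub_cornerStaircase` does for `a < 20`).  Self-avoidance and injectivity are NEVER needed.
* S4 `stub_ceiling_of_exponent` (provable now, S–M): `(∃ γ, HasEnumerationExponent 2 1 γ) → S1`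
  (`Zd.hasEnumerationExponent_one_iff`: `c_n/(A μ^n n^{γ-1}) → 1`, so `a_n ≤ 2A n^{γ−1}` eventually, finitely many
  small `n` by `Finset.sup`/`max`, and `(n+1)^C` dominates both for `C` large; `x_c = μ⁻¹`, `criticalFugacity`,
  `Zd.connectiveConstant_two`).  Consumed by the by-product `TubeLowerBound_of_hasEnumerationExponent`, not by
  `TubeLowerBound_of` (same status as lieb-simon-star's registered S5/S6).
* `TubeLowerBound_of : TubeLowerBound` := `tightTubeFloor_iff_crux.1 (stub_octantReduction (S3 S2 S1))` — the landed
  octant reduction (p80734) and `TightTubeFloor ↔ TubeLowerBound` (`Negative.tightTubeFloor_iff`) give the crux BY NAME.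
* By-products (no sorry of their own): `TubeLowerBound_of_countCeiling : S1-statement → TubeLowerBound`,
  `TubeLowerBound_of_hasEnumerationExponent`, `TubeLowerBound_of_enumerationExponentConjecture2D` — the crux is
  CLOSED MODULO the registered conjecture `EnumerationExponentConjecture2D` (indeed modulo any finite γ) once S2, S3 land.

All statements over TREE VOCABULARY (`Zd.saws`, `Zd.sawFun`, `Zd.count`, `criticalFugacity`, `Site.toComplex`) plus the
landed defs of `SAWRenewalTightnessTubeLowerBoundDefs.lean`; floors in the `∃ N` partial-sum form with `0 ≤ C`.

Disproof.lean (cdisprove cycles 1–2, landed as `Theorems/TubeLowerBound/Negative/TubeLowerBoundLoadBearing|FixedWidth|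
SubcriticalRenewalFloorTargets`, read in full 2026-08-16T11:50Z) honoured: `not_atFugacity_of_lt` — criticality enters
only through the Simon–Lieb domino (`θ_R(x) ≥ 1` iff `x ≥ x_c`) and through S1 (false for no `x`; it is fugacity-free in
`c_n` but the MASS form uses `x_c μ = 1`); `not_withoutDist` — the domino scale `R ≍ ℓ/80` grows with `ℓ`, the number of
pieces is bounded (≤ 4·40 + O(1)) only because of that; at fixed width the same chain has `∝ ℓ` pieces and is exponential;
`not_withoutSlack` — the `+2` is spent on the unit staircase for `a < 120` and on lattice rounding; `constraints` /
`exponent_eq_zero_of_withoutOneLe` — `0 ≤ C` everywhere, `FirstOctantTubeFloor` works at `ℓ₀ ≥ 1`; `not_allN` — `∃ N`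
throughout (the repair only SHORTENS walks, budgets add); `twoPoint_floor` — consistent: the line delivers the MS p.259
floor too, conditionally on S1; `tightTubeFloor_iff` — acknowledged (S3 ∘ octant reduction IS the crux at scale ℓ₀).
No stub is an instance of a refuted variant; `ledger negatives`: nothing on count ceilings / multi-valued maps.
-/

noncomputable section

namespace Summit.CriticalPhenomena.SAWScalingLimit.Cruxes.TubeLowerBound.LassoRepair

open scoped BigOperators Classical
open Filter Topology
open Literature.Probability.LatticeModels
open Literature.Probability.RandomPlanarGeometry Literature.Probability.RandomPlanarGeometry.SAW
open Summit.CriticalPhenomena.SAWScalingLimit.Theses.SAWRenewalTightness (TubeLowerBound)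
open Summit.CriticalPhenomena.SAWScalingLimit.Theorems.TubeLowerBound.LiebSimonStar

set_option linter.unusedVariables false

/-! ## Registered stubs (`sorry` only here) -/

/-- **S1 `stub_countCeiling`** — POLYNOMIAL HAMMERSLEY–WELSH in mass form (OPEN, the hardest stub, the lead's):
there is `C ≥ 0` with `c_n x_c^n ≤ (n+1)^C` for every `n` (`c_n = Zd.count 2 n` the number of `n`-step SAWs on `ℤ²`,
`x_c = μ⁻¹`).  Since `c_n x_c^n ≥ 1` (`Zd.pow_connectiveConstant_le_count`) this says `1 ≤ a_n ≤ (n+1)^C`: the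
enumeration exponent `γ` is finite.  In print only `a_n ≤ e^{κ√n}` (Hammersley–Welsh 1962) and `e^{O(n^{1/2−ε})}` along a
subsequence (DGHM 2020); implied by `EnumerationExponentConjecture2D` (S4).  Conjecturally `a_n ∼ A n^{11/32}`. -/
theorem stub_countCeiling :
    ∃ C : ℝ, 0 ≤ C ∧ ∀ n : ℕ, (Zd.count 2 n : ℝ) * criticalFugacity ^ n ≤ ((n : ℝ) + 1) ^ C := by
  sorry

/-- **S2 `stub_lassoGluing`** — the TWO-PIECE LASSO INEQUALITY (provable now, M–L).  For predicates `P ⊆ R` and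
`e₁ + Q ⊆ R` (no separation assumed) the confined two-point partial sums satisfy
`T(P,e₁,M) · T(Q,e₂,N) ≤ (M+1) · A(M) · A(N) · T(R, e₁+e₂, M+N)` with `A(M) = Σ_{k ≤ M} c_k x_c^k`: follow the first
walk to its FIRST vertex on the translate of the second, then the second to its end (a self-avoiding, `R`-confined,
shorter walk `0 → e₁ + e₂`); the fibre over an output is indexed by the jump time `t ≤ M` and the two discarded
self-avoiding pieces (tail of the first walk, head of the second), whose `x_c`-masses are bounded by the UNCONFINED
sums `A(M)`, `A(N)`.  See the module docstring for the map, its injectivity and the bookkeeping. -/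
theorem stub_lassoGluing :
    ∀ (P Q R : Site 2 → Prop) [DecidablePred P] [DecidablePred Q] [DecidablePred R]
      (e₁ e₂ e : Site 2), e₁ + e₂ = e → (∀ p, P p → R p) → (∀ q, Q q → R (e₁ + q)) → ∀ (M N : ℕ),
      (∑ m ∈ Finset.range (M + 1),
          ∑ _ω ∈ (Zd.sawFun 2 m e₁).filter (fun ω => ∀ i ≤ m, P (ω i)), criticalFugacity ^ m) *
        (∑ n ∈ Finset.range (N + 1),
          ∑ _ω ∈ (Zd.sawFun 2 n e₂).filter (fun ω => ∀ i ≤ n, Q (ω i)), criticalFugacity ^ n) ≤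
      ((M : ℝ) + 1) * (∑ k ∈ Finset.range (M + 1), (Zd.count 2 k : ℝ) * criticalFugacity ^ k) *
        (∑ k ∈ Finset.range (N + 1), (Zd.count 2 k : ℝ) * criticalFugacity ^ k) *
        ∑ k ∈ Finset.range (M + N + 1),
          ∑ _ω ∈ (Zd.sawFun 2 k e).filter (fun ω => ∀ i ≤ k, R (ω i)), criticalFugacity ^ k :=
  Summit.CriticalPhenomena.SAWScalingLimit.Theorems.TubeLowerBound.LassoRepair.stub_lassoGluing  -- LANDED p103890 (wave 1)

/-- **S3 `stub_dominoStaircase`** — LASSO STAIRCASE OF DOMINOES (provable now, L): the lasso inequality (S2) and the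
count ceiling (S1) give `FirstOctantTubeFloor`.  Legs of the corner staircase `Q_j = (⌊ja/n⌋, ⌊jb/n⌋)` (`n = min 40 a`
rounds) are realised by the landed centre-start dominoes `stub_dominoFloor stub_quarterFlux : DominoFloor`
(`0 → (2R+1)e₁` inside `[−R,3R+1]×[−R,R]`, mass `≥ x_c/(16(2R+1))`; vertical ones by `CornerStaircase.tubeMass_swap_le`)
plus `≤ 1` parity unit step per leg (`≤ 2` unit steps for legs of length `≤ 2`); consecutive pieces OVERLAP and are glued
by S2 with `R :=` the tube predicate, each gluing costing `1/((M+1) A(M) A(N)) ≥ (N_tot+1)^{−(2C+3)}`,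
`N_tot ≤ 1600 ℓ₀²`; boxes lie in the `ℓ₀/10 + 2` tube by `infDist_segment_le_coord`; `a < 120`: the digital staircase.
Self-avoidance / injectivity are never needed.  Output `C' , c'` depend on `C` only. -/
theorem stub_dominoStaircase :
    (∀ (P Q R : Site 2 → Prop) [DecidablePred P] [DecidablePred Q] [DecidablePred R]
      (e₁ e₂ e : Site 2), e₁ + e₂ = e → (∀ p, P p → R p) → (∀ q, Q q → R (e₁ + q)) → ∀ (M N : ℕ),
      (∑ m ∈ Finset.range (M + 1),
          ∑ _ω ∈ (Zd.sawFun 2 m e₁).filter (fun ω => ∀ i ≤ m, P (ω i)), criticalFugacity ^ m) *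
        (∑ n ∈ Finset.range (N + 1),
          ∑ _ω ∈ (Zd.sawFun 2 n e₂).filter (fun ω => ∀ i ≤ n, Q (ω i)), criticalFugacity ^ n) ≤
      ((M : ℝ) + 1) * (∑ k ∈ Finset.range (M + 1), (Zd.count 2 k : ℝ) * criticalFugacity ^ k) *
        (∑ k ∈ Finset.range (N + 1), (Zd.count 2 k : ℝ) * criticalFugacity ^ k) *
        ∑ k ∈ Finset.range (M + N + 1),
          ∑ _ω ∈ (Zd.sawFun 2 k e).filter (fun ω => ∀ i ≤ k, R (ω i)), criticalFugacity ^ k) →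
    (∃ C : ℝ, 0 ≤ C ∧ ∀ n : ℕ, (Zd.count 2 n : ℝ) * criticalFugacity ^ n ≤ ((n : ℝ) + 1) ^ C) →
    FirstOctantTubeFloor :=
  Summit.CriticalPhenomena.SAWScalingLimit.Theorems.TubeLowerBound.LassoRepair.stub_dominoStaircase  -- LANDED p111288 (helpers p107108)

/-- **S4 `stub_ceiling_of_exponent`** — the count ceiling from an enumeration exponent (provable now, S–M): if
`c_n ∼ A μ^n n^{γ−1}` for some `γ` (`HasEnumerationExponent 2 1 γ`, BDGS2012 (1.21); `Zd.hasEnumerationExponent_one_iff`)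
then `c_n x_c^n ≤ (n+1)^C` for all `n` (eventually `≤ 2A n^{γ−1}`, finitely many small `n`).  In particular the
registered conjecture `EnumerationExponentConjecture2D` (`γ = 43/32`) gives S1. -/
theorem stub_ceiling_of_exponent :
    (∃ γ : ℝ, Zd.HasEnumerationExponent 2 1 γ) →
    ∃ C : ℝ, 0 ≤ C ∧ ∀ n : ℕ, (Zd.count 2 n : ℝ) * criticalFugacity ^ n ≤ ((n : ℝ) + 1) ^ C :=
  Summit.CriticalPhenomena.SAWScalingLimit.Theorems.TubeLowerBound.LassoRepair.stub_ceiling_of_exponent  -- LANDED p110864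

/-! ## The composition: S2, S1, S3 and the landed octant reduction give the crux BY NAME -/

/-- **`TubeLowerBound` from the line `lasso-repair-poly-hw`** (kernel-checked glue, no `sorry` of its own): the lasso
staircase (S3, fed by the lasso inequality S2 and the count ceiling S1) gives `FirstOctantTubeFloor`, the landed octant
reduction gives `TightTubeFloor`, which is the crux at its own scale (`tightTubeFloor_iff_crux`). -/
theorem TubeLowerBound_of : TubeLowerBound :=
  tightTubeFloor_iff_crux.1 (stub_octantReduction (stub_dominoStaircase stub_lassoGluing stub_countCeiling))

/-! ## By-products: the tight tube floor modulo the registered conjecture `EnumerationExponentConjecture2D`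

(The crux-level corollaries `TubeLowerBound_of_countCeiling / _of_hasEnumerationExponent /
_of_enumerationExponentConjecture2D` live in the lead's Theorems file `SAWRenewalTightnessTubeLowerBoundOfCountCeiling.lean`
(work/OfCountCeiling.lean), so that this skeleton has exactly ONE theorem concluding the crux.) -/

/-- **`TightTubeFloor` from ANY enumeration exponent** (consumes S4): if `c_n ∼ A μ^n n^{γ−1}` on `ℤ²` for some `γ`
then the crux's own-scale form `TightTubeFloor` holds — S4 gives the count ceiling, S3 (fed by S2) the first-octant
floor, the landed octant reduction the rest. -/
theorem tightTubeFloor_of_hasEnumerationExponent {γ : ℝ} (h : Zd.HasEnumerationExponent 2 1 γ) :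
    TightTubeFloor :=
  stub_octantReduction (stub_dominoStaircase stub_lassoGluing (stub_ceiling_of_exponent ⟨γ, h⟩))

/-- **`TightTubeFloor` from the registered conjecture `γ = 43/32`** (`EnumerationExponentConjecture2D`, BDGS2012
§1.5.1 (1.22), Nienhuis 1982): its `λ = 1` instance is an enumeration exponent of the strictly self-avoiding walk. -/
theorem tightTubeFloor_of_enumerationExponentConjecture2D (h : Zd.EnumerationExponentConjecture2D) :
    TightTubeFloor :=
  tightTubeFloor_of_hasEnumerationExponent (h 1 one_pos le_rfl)

/-! ## Sanity: the proved domino (input of S3) and the negative knowledge checked against -/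

/-- The centre-start domino floor is a THEOREM of the tree (Simon–Lieb quarter flux + reflect-and-Schwarz). -/
example : DominoFloor := stub_dominoFloor stub_quarterFlux

/-- The refuted FIXED-WIDTH variant (tube radius not tied to `|u − v|`): every box of S3 has radius `≍ ℓ₀/80`, widening
linearly with the span, so no stub is an instance. -/
example : ¬ (∃ C c : ℝ, 0 < c ∧ ∀ (u v : Site 2) (ℓ : ℝ), 1 ≤ ℓ →
    ∃ N : ℕ, c * ℓ ^ (-C) ≤
      Summit.CriticalPhenomena.SAWScalingLimit.Theorems.TubeLowerBound.Negative.tubeMass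
        criticalFugacity u v (ℓ / 10 + 2) N) :=
  Summit.CriticalPhenomena.SAWScalingLimit.Theorems.TubeLowerBound.Negative.not_withoutDist

end Summit.CriticalPhenomena.SAWScalingLimit.Cruxes.TubeLowerBound.LassoRepair

end
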